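import Summits.QuantumFields.BalabanUV.Beta.GAN24.ChargeTowerInduction

/-!
# `BalabanUV.Beta.GAN24.ExitChargeParityBase` — binder row G-an2-4 ∕ (CONV-C), the (S) row of RULING R-gan24p1-g27-1 PART B (viii), sub-step (INV-X) ∕ (INV-Z),
# FIELD HALF, LEVEL 0: **THE exit⊗exit CHARGE FUNCTION OF THE LEVEL-0 S TABLE IN CLOSED FORM, AND ITS PARITY UNDER THE POINT INVERSION OF THE SLOT**
# (the base of the PARITY TOWER for road-P2 g39's displayed hypothesis `hZS`; companion `ExitChargeParityTower`)

NOT IN PRINT; OUR BOOKKEEPING ([folklore] by name: leaf-02 g57 PART B `SrecChargeBlockPotentials.tsum_prod_exitWt_srecAt_zero` ((I3)_0 with ANY primitives), PART A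
`WilsonPairFormCharge.curvAdj_curv_pairForm_coord_same`, PART D `SrecChargeLamDropsAllLevels.tsum_prod_exitWt_srecAt_eq_spureRecAt`, leaf-02 g55 `FaceChargeCurlResummation.curv_faceForm`,
leaf-06 g46 `EdgePlaquettePotential.wedge_blk_eq`, road-P2 g42 `ChargeTowerInduction.exitWt_blk_eq ∕ staircase_forwardDiff ∕ curvAdj_const_mul ∕ abs_exitInd_le_one`; 0 `def`, 0 cited
fact, 0 `def … : Prop`, 0 sorry).  HONEST FRAMING (cell contract, verbatim): «discharging `BetaPertH` makes Bałaban's UV stability UNCONDITIONAL — a real constructive-QFT result;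
it is NOT the continuum limit and NOT the Clay problem.»  HONEST DEPENDENCY (verbatim): «continuum YM on T⁴ ⇐ BetaPertH ∧ nine spine estimates (0/9 proved); BetaPertH ⇐ (D1) ∧ (D4) ∧
CAP+tail; G-an2-4 gates asym, D1 and NE2/3/4.»

WHAT (in-block root `ρ = toSite r`, all `cE cVH cΛ`, directions `α β`, the `N`-EXIT INDICATOR `𝟙^{exit,N}_a(x) := [x_a % N = N − 1]`, the CORNER 2-FORM
`Ω^N_{αβ} κ l x := E_{αβ}(κ,l)·𝟙^{exit,N}_α(x)·𝟙^{exit,N}_β(x)`, `E_{αβ}(κ,l) = [κ=α ∧ l=β] − [κ=β ∧ l=α]`):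
* §1 `curvAdj_pointInv_of_even` — for ANY 2-form `F` EVEN under the plaquette inversion `F κ l (c − e_κ − e_l − x) = F κ l x`, the co-derivative is ODD under the bond inversion:
  `curvAdj F μ (c − e_μ − y) = −curvAdj F μ y` (pure bookkeeping on `AffineAveraging.curvAdj`); `emod_neg_two_sub_iff'`, **`cornerForm_even`** (the corner 2-form is even for every
  centre `c = N•t + (N−1)•𝟙`: an exit plaquette inverts to an exit plaquette); hence **`curvAdj_cornerForm_pointInv`**.
* §2 **`tsum_exitWt_srecAt_zero_eq_curvAdj_cornerForm`** (`α ≠ β`, `1 ≤ M`): THE LEVEL-0 exit⊗exit CHARGE FUNCTION IN CLOSED FORM —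
  `Σ'_{(x,z)} 𝟙^{exit,Lc}_α(x)𝟙^{exit,M}((blk x)_α)·𝟙^{exit,Lc}_β(z)𝟙^{exit,M}((blk z)_β)·SrecAt … 0 κ u x z (inl α)(inl β) = (−cE∕2)·(curvAdj Ω^{Lc·M}_{αβ})_κ(u)`
  (PART B with the staircase primitives `⌊·∕M⌋`, `⌊⌊t∕Lc⌋∕M⌋ = ⌊t∕(Lc·M)⌋`, `curv`(face form) `= 2·Ω` by `curv_faceForm` ⨾ `wedge_blk_eq`); `…_same` (`α = β`: the charge is `0`, PART A).
* §3 THE BASE OF THE PARITY TOWER: **`exitCharge_srecAt_zero_pointInv`** (pulled-back weights, FULL member) and **`exitCharge_spureRecAt_zero_pointInv`** (product-period weights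
  `𝟙^{exit,Lc·M}`, PURE member, via (W) and PART D): for EVERY `M ≥ 1`, every integer vector `t`, `c := (Lc·M)•t + (Lc·M − 1)•𝟙`, every slot `(κ, u)` and ALL `α β`:
  `C_0(κ, c − e_κ − u) = −C_0(κ, u)` — the level-0 exit⊗exit charge function is ODD under the inversion of its slot bond through any centre compatible with the period.
READING.  Road-P2 g39's (INV-Z) field hypothesis `hZS` («`Z_ω(S κ (c_y − e_κ − u)) = t_κ·Z_ω′(S κ u)`», `t = −1` on the engine E26) is, for the consumer's class `ω = exit_α ⊗ exit_β`
(RULING R-gan24p1-g28-1 (ii): the transported currency `u_a ⊗ u_b = Lc⁻²exit ⊗ Lc⁻²exit`), a PARITY statement about the exit⊗exit charge function; this file is its level 0, the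
companion climbs it to every level through (I1) and `CoDressedColumnPointInversion.colH_pointInv_ctr_gen`.  What this file does NOT do: levels `≥ 1`; other weight classes (entry ∕
slab: not inversion-invariant); off-centre roots; anything of (W-γ) ∕ (S) ∕ (Q-R) ∕ (LT) ∕ (Q-L) ∕ (C) ∕ «T2Shape» ∕ (hW, hWall).  Asserts NO value of Bałaban's tables beyond the typed
identity; NEVER «G-an2-4 closed» as (CONV-C); NOT D1, NOT `BetaPertH`, NOT continuum, NOT Clay.  2026-08-22 (gan24-formalise-leaf-02 gen 58); no existing file touched.
-/

noncomputable section

open Finset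
open scoped BigOperators
open Literature.MathematicalPhysics.QuantumFieldTheory
open Literature.MathematicalPhysics.QuantumFieldTheory.Balaban1983to89
open Literature.MathematicalPhysics.QuantumFieldTheory.Balaban1983to89.Beta
open ExpKernelCalculus (Site MKer)
open AffineAveraging (Form1 Form2 box toSite unitVec unitVec_apply dz curv curvAdj)
open AveragingContours (blk)
open OneStepResolventKernel (Fib)
open Summit.QuantumFields.BalabanUV.Beta.AxialDressingRooted (one_le_of_neZero)
open Summit.QuantumFields.BalabanUV.Beta.SpineRooted (SpureRecAt)
open Summit.QuantumFields.BalabanUV.Beta.WardLocusRecursive (SrecAt)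
open Summit.QuantumFields.BalabanUV.Beta.GAN24.FaceChargeCurlResummation (curv_faceForm)
open Summit.QuantumFields.BalabanUV.Beta.GAN24.EdgePlaquettePotential (wedge_blk_eq)
open Summit.QuantumFields.BalabanUV.Beta.GAN24.WilsonPairFormCharge (curvAdj_curv_pairForm_coord_same)
open Summit.QuantumFields.BalabanUV.Beta.GAN24.SrecChargeBlockPotentials (tsum_prod_exitWt_srecAt_zero curvAdj_curv_const_mul)
open Summit.QuantumFields.BalabanUV.Beta.GAN24.SrecChargeLamDropsAllLevels (tsum_prod_exitWt_srecAt_eq_spureRecAt)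
open Summit.QuantumFields.BalabanUV.Beta.GAN24.ChargeTowerInduction (exitWt_blk_eq staircase_forwardDiff curvAdj_const_mul abs_exitInd_le_one)

namespace Summit.QuantumFields.BalabanUV.Beta.GAN24.ExitChargeParityBase

variable {d : ℕ}

/-! ## §1 Even 2-forms have odd co-derivative; the corner 2-form of the exit plaquettes is even -/

/-- [folklore] **AN EVEN 2-FORM HAS AN ODD CO-DERIVATIVE.**  If `F κ l (c − e_κ − e_l − x) = F κ l x` for all plaquettes (the plaquette based at `x` with edges `κ, l` inverts
through `c∕2` to the plaquette based at `c − e_κ − e_l − x`), then `curvAdj F μ (c − e_μ − y) = −curvAdj F μ y` (the bond `(μ, y)` inverts to the bond based at `c − e_μ − y`). -/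
theorem curvAdj_pointInv_of_even (F : Form2 (d + 1) ℝ) (c : Site (d + 1))
    (hF : ∀ (κ l : Fin (d + 1)) (x : Site (d + 1)), F κ l (c - unitVec κ - unitVec l - x) = F κ l x) (μ : Fin (d + 1)) (y : Site (d + 1)) :
    curvAdj F μ (c - unitVec μ - y) = -curvAdj F μ y := by
  simp only [AffineAveraging.curvAdj]
  have h1 : ∀ l : Fin (d + 1), F μ l (c - unitVec μ - y) = F μ l (y - unitVec l) := fun l => by
    rw [← hF μ l (y - unitVec l)]; congr 1; abel
  have h2 : ∀ l : Fin (d + 1), F μ l (c - unitVec μ - y - unitVec l) = F μ l y := fun l => by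
    rw [← hF μ l y]; congr 1; abel
  have h3 : ∀ κ : Fin (d + 1), F κ μ (c - unitVec μ - y - unitVec κ) = F κ μ y := fun κ => by
    rw [← hF κ μ y]; congr 1; abel
  have h4 : ∀ κ : Fin (d + 1), F κ μ (c - unitVec μ - y) = F κ μ (y - unitVec κ) := fun κ => by
    rw [← hF κ μ (y - unitVec κ)]; congr 1; abel
  simp only [h1, h2, h3, h4, neg_add, ← Finset.sum_neg_distrib, neg_sub]

/-- [folklore] `(−2 − s) % N = N − 1 ↔ s % N = N − 1` (`1 ≤ N`): both say `N ∣ s + 1`. -/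
theorem emod_neg_two_sub_iff' {N : ℕ} (hN : 1 ≤ N) (s : ℤ) : (-2 - s) % (N : ℤ) = (N : ℤ) - 1 ↔ s % (N : ℤ) = (N : ℤ) - 1 := by
  have hN0 : (0 : ℤ) < N := by exact_mod_cast hN
  have key : ∀ u : ℤ, u % (N : ℤ) = (N : ℤ) - 1 ↔ (N : ℤ) ∣ u + 1 := by
    intro u
    constructor
    · intro h
      have e := Int.emod_add_ediv_mul u (N : ℤ)
      exact ⟨u / (N : ℤ) + 1, by linear_combination -e + h⟩
    · rintro ⟨k, hk⟩
      have eu : u = (N : ℤ) - 1 + (N : ℤ) * (k - 1) := by linear_combination hk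
      rw [eu, Int.add_mul_emod_self_left]
      exact Int.emod_eq_of_lt (by linarith) (by linarith)
  rw [key, key, show -2 - s + 1 = -(s + 1) by ring, Int.dvd_neg]

/-- [folklore] One coordinate of the inverted plaquette base: `((N•t + (N−1)•𝟙) − e_κ − e_l − x)_a % N = N − 1 ↔ x_a % N = N − 1` whenever `a ∈ {κ, l}` contributes exactly one unit
(`[κ = a] + [l = a] = 1`) — here packaged for the two cases the corner form needs. -/
theorem exitInd_plaquetteInv {N : ℕ} (hN : 1 ≤ N) (t x : Site (d + 1)) {κ l a : Fin (d + 1)}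
    (h : (if κ = a then (1 : ℤ) else 0) + (if l = a then (1 : ℤ) else 0) = 1) :
    ((N : ℤ) • t + (fun _ : Fin (d + 1) => (N : ℤ) - 1) - unitVec κ - unitVec l - x) a % (N : ℤ) = (N : ℤ) - 1 ↔ x a % (N : ℤ) = (N : ℤ) - 1 := by
  have e : ((N : ℤ) • t + (fun _ : Fin (d + 1) => (N : ℤ) - 1) - unitVec κ - unitVec l - x) a = (-2 - x a) + (N : ℤ) * (t a + 1) := by
    simp only [Pi.add_apply, Pi.sub_apply, Pi.smul_apply, smul_eq_mul, unitVec_apply]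
    rw [show (if a = κ then (1 : ℤ) else 0) = if κ = a then 1 else 0 by simp only [eq_comm],
      show (if a = l then (1 : ℤ) else 0) = if l = a then 1 else 0 by simp only [eq_comm]]
    linear_combination -h
  rw [e, Int.add_mul_emod_self_left, emod_neg_two_sub_iff' hN]

/-- NOT IN PRINT; OUR BOOKKEEPING.  **THE CORNER 2-FORM IS EVEN** (every period `N ≥ 1`, every centre `c = N•t + (N−1)•𝟙`, ALL `α β`): with
`Ω κ l x = ([κ=α ∧ l=β] − [κ=β ∧ l=α])·𝟙^{exit,N}_α(x)·𝟙^{exit,N}_β(x)`, `Ω κ l (c − e_κ − e_l − x) = Ω κ l x` — an exit plaquette inverts to an exit plaquette. -/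
theorem cornerForm_even {N : ℕ} (hN : 1 ≤ N) (t : Site (d + 1)) (α β κ l : Fin (d + 1)) (x : Site (d + 1)) :
    ((if κ = α ∧ l = β then (1 : ℝ) else 0) - (if κ = β ∧ l = α then (1 : ℝ) else 0))
        * ((if ((N : ℤ) • t + (fun _ : Fin (d + 1) => (N : ℤ) - 1) - unitVec κ - unitVec l - x) α % (N : ℤ) = (N : ℤ) - 1 then (1 : ℝ) else 0)
          * (if ((N : ℤ) • t + (fun _ : Fin (d + 1) => (N : ℤ) - 1) - unitVec κ - unitVec l - x) β % (N : ℤ) = (N : ℤ) - 1 then (1 : ℝ) else 0))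
      = ((if κ = α ∧ l = β then (1 : ℝ) else 0) - (if κ = β ∧ l = α then (1 : ℝ) else 0))
        * ((if x α % (N : ℤ) = (N : ℤ) - 1 then (1 : ℝ) else 0) * (if x β % (N : ℤ) = (N : ℤ) - 1 then (1 : ℝ) else 0)) := by
  by_cases hαβ : α = β
  · subst hαβ
    simp
  by_cases h1 : κ = α ∧ l = β
  · obtain ⟨hκ, hl⟩ := h1
    have e1 := exitInd_plaquetteInv hN t x (κ := κ) (l := l) (a := α)
      (by rw [if_pos hκ, if_neg (fun h : l = α => hαβ (h.symm.trans hl))]; norm_num)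
    have e2 := exitInd_plaquetteInv hN t x (κ := κ) (l := l) (a := β)
      (by rw [if_neg (fun h : κ = β => hαβ (hκ.symm.trans h)), if_pos hl]; norm_num)
    simp only [e1, e2]
  by_cases h2 : κ = β ∧ l = α
  · obtain ⟨hκ, hl⟩ := h2
    have e1 := exitInd_plaquetteInv hN t x (κ := κ) (l := l) (a := α)
      (by rw [if_neg (fun h : κ = α => hαβ (h.symm.trans hκ)), if_pos hl]; norm_num)
    have e2 := exitInd_plaquetteInv hN t x (κ := κ) (l := l) (a := β)
      (by rw [if_pos hκ, if_neg (fun h : l = β => hαβ (hl.symm.trans h))]; norm_num)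
    simp only [e1, e2]
  rw [if_neg h1, if_neg h2, sub_zero, zero_mul, zero_mul]

/-- NOT IN PRINT; OUR BOOKKEEPING.  **THE CO-DERIVATIVE OF THE CORNER 2-FORM IS ODD UNDER THE BOND INVERSION** (every `N ≥ 1`, centre `c = N•t + (N−1)•𝟙`, all `α β μ y`):
`(curvAdj Ω)_μ(c − e_μ − y) = −(curvAdj Ω)_μ(y)`. -/
theorem curvAdj_cornerForm_pointInv {N : ℕ} (hN : 1 ≤ N) (t : Site (d + 1)) (α β μ : Fin (d + 1)) (y : Site (d + 1)) :
    curvAdj (fun κ l x => ((if κ = α ∧ l = β then (1 : ℝ) else 0) - (if κ = β ∧ l = α then (1 : ℝ) else 0))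
        * ((if x α % (N : ℤ) = (N : ℤ) - 1 then (1 : ℝ) else 0) * (if x β % (N : ℤ) = (N : ℤ) - 1 then (1 : ℝ) else 0))) μ
        ((N : ℤ) • t + (fun _ : Fin (d + 1) => (N : ℤ) - 1) - unitVec μ - y)
      = -curvAdj (fun κ l x => ((if κ = α ∧ l = β then (1 : ℝ) else 0) - (if κ = β ∧ l = α then (1 : ℝ) else 0))
        * ((if x α % (N : ℤ) = (N : ℤ) - 1 then (1 : ℝ) else 0) * (if x β % (N : ℤ) = (N : ℤ) - 1 then (1 : ℝ) else 0))) μ y :=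
  curvAdj_pointInv_of_even _ _ (fun κ l x => cornerForm_even hN t α β κ l x) μ y

/-! ## §2 The level-0 exit⊗exit charge function in closed form -/

section Level0

variable {Lc : ℕ} [NeZero Lc] {r : Fin (d + 1) → ℕ}

/-- NOT IN PRINT; OUR BOOKKEEPING.  **THE LEVEL-0 exit⊗exit CHARGE FUNCTION IN CLOSED FORM** (in-block root, all `cE cVH cΛ`, `α ≠ β`, every extra period `M ≥ 1`, every slot):
`Σ'_{(x,z)} 𝟙^{exit,Lc}_α(x)𝟙^{exit,M}((blk x)_α)·𝟙^{exit,Lc}_β(z)𝟙^{exit,M}((blk z)_β)·SrecAt … 0 κ u x z (inl α)(inl β) = (−cE∕2)·(curvAdj Ω^{Lc·M}_{αβ})_κ(u)`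
— PART B `tsum_prod_exitWt_srecAt_zero` with the staircase primitives `F_i = ⌊·∕M⌋` (`staircase_forwardDiff`), `⌊⌊t∕Lc⌋∕M⌋ = ⌊t∕(Lc·M)⌋`, and `curv`(face form at scale
`Lc·M`) `= 2·Ω^{Lc·M}` (`curv_faceForm` ⨾ `wedge_blk_eq`).  The same function road-P2's `ChargeTowerInduction` §3 writes as `d*d` of a hidden potential; here no potential. -/
theorem tsum_exitWt_srecAt_zero_eq_curvAdj_cornerForm (hr : r ∈ box (d + 1) Lc) (cE cVH cΛ : ℝ) {α β : Fin (d + 1)} (hαβ : α ≠ β) {M : ℕ} (hM : 1 ≤ M)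
    (κ : Fin (d + 1)) (u : Site (d + 1)) :
    ∑' xz : Site (d + 1) × Site (d + 1),
        (if xz.1 α % (Lc : ℤ) = (Lc : ℤ) - 1 then (if blk Lc xz.1 α % (M : ℤ) = (M : ℤ) - 1 then (1 : ℝ) else 0) else 0)
          * (if xz.2 β % (Lc : ℤ) = (Lc : ℤ) - 1 then (if blk Lc xz.2 β % (M : ℤ) = (M : ℤ) - 1 then (1 : ℝ) else 0) else 0)
          * SrecAt d Lc (toSite r) cE cVH cΛ 0 κ u xz.1 xz.2 (Sum.inl α) (Sum.inl β)
      = (-(cE / 2)) * curvAdj (fun κ' l x => ((if κ' = α ∧ l = β then (1 : ℝ) else 0) - (if κ' = β ∧ l = α then (1 : ℝ) else 0))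
          * ((if x α % ((Lc * M : ℕ) : ℤ) = ((Lc * M : ℕ) : ℤ) - 1 then (1 : ℝ) else 0)
            * (if x β % ((Lc * M : ℕ) : ℤ) = ((Lc * M : ℕ) : ℤ) - 1 then (1 : ℝ) else 0))) κ u := by
  classical
  have hLc : 1 ≤ Lc := one_le_of_neZero Lc
  have hLc0 : (0 : ℤ) ≤ Lc := by exact_mod_cast (Nat.zero_le Lc)
  have hL : 1 ≤ Lc * M := Nat.one_le_iff_ne_zero.2 (Nat.mul_ne_zero (by omega) (by omega))
  have hF : ∀ t : ℤ, (((((t + 1) / (M : ℤ) : ℤ)) : ℝ)) - (((t / (M : ℤ) : ℤ)) : ℝ) = if t % (M : ℤ) = (M : ℤ) - 1 then (1 : ℝ) else 0 :=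
    staircase_forwardDiff hM
  rw [tsum_prod_exitWt_srecAt_zero hLc hr cE cVH cΛ (F₁ := fun t : ℤ => (((t / (M : ℤ) : ℤ)) : ℝ)) (F₂ := fun t : ℤ => (((t / (M : ℤ) : ℤ)) : ℝ))
    hF hF (fun s => abs_exitInd_le_one _ s) (fun s => abs_exitInd_le_one _ s) κ u α β, curvAdj_curv_const_mul]
  -- the primitives of the pulled-back weights are the staircases at scale `Lc·M`
  have epot : (fun β' z => dz (fun w : Fin (d + 1) → ℤ => (((w β / (Lc : ℤ) / (M : ℤ) : ℤ)) : ℝ)) β' z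
        * ((((z α / (Lc : ℤ) / (M : ℤ) : ℤ)) : ℝ) + (((z + B6BondElimination.unitVec β') α / (Lc : ℤ) / (M : ℤ) : ℤ) : ℝ)))
      = fun β' z => dz (fun w : Fin (d + 1) → ℤ => (((w β / ((Lc * M : ℕ) : ℤ) : ℤ)) : ℝ)) β' z
        * ((((z α / ((Lc * M : ℕ) : ℤ) : ℤ)) : ℝ) + (((z + B6BondElimination.unitVec β') α / ((Lc * M : ℕ) : ℤ) : ℤ) : ℝ)) := by
    funext β' z
    simp only [Int.ediv_ediv_of_nonneg hLc0, Nat.cast_mul]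
  rw [epot]
  -- the face form's curl is twice the corner 2-form
  have e : curv (fun β' z => dz (fun w : Fin (d + 1) → ℤ => (((w β / ((Lc * M : ℕ) : ℤ) : ℤ)) : ℝ)) β' z
        * ((((z α / ((Lc * M : ℕ) : ℤ) : ℤ)) : ℝ) + (((z + B6BondElimination.unitVec β') α / ((Lc * M : ℕ) : ℤ) : ℤ) : ℝ)))
      = fun κ' l x => 2 * (((if κ' = α ∧ l = β then (1 : ℝ) else 0) - (if κ' = β ∧ l = α then (1 : ℝ) else 0))
          * ((if x α % ((Lc * M : ℕ) : ℤ) = ((Lc * M : ℕ) : ℤ) - 1 then (1 : ℝ) else 0)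
            * (if x β % ((Lc * M : ℕ) : ℤ) = ((Lc * M : ℕ) : ℤ) - 1 then (1 : ℝ) else 0))) := by
    funext κ' l x
    rw [curv_faceForm hαβ κ' l x, wedge_blk_eq hL hαβ κ' l x]
  rw [e, curvAdj_const_mul]
  ring

/-- NOT IN PRINT; OUR BOOKKEEPING.  **SAME DIRECTION: THE LEVEL-0 CHARGE IS ZERO** (`α = β`; every `M ≥ 1`): PART B with the staircase primitives ⨾ PART A
`curvAdj_curv_pairForm_coord_same` (the same-direction pair form has no Maxwell image).  Road-P2 g42's `ChargeTowerSameDirection` §1 is the same fact in its `1·d*d 0 + 0` spelling. -/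
theorem tsum_exitWt_srecAt_zero_same (hr : r ∈ box (d + 1) Lc) (cE cVH cΛ : ℝ) (α : Fin (d + 1)) {M : ℕ} (hM : 1 ≤ M) (κ : Fin (d + 1)) (u : Site (d + 1)) :
    ∑' xz : Site (d + 1) × Site (d + 1),
        (if xz.1 α % (Lc : ℤ) = (Lc : ℤ) - 1 then (if blk Lc xz.1 α % (M : ℤ) = (M : ℤ) - 1 then (1 : ℝ) else 0) else 0)
          * (if xz.2 α % (Lc : ℤ) = (Lc : ℤ) - 1 then (if blk Lc xz.2 α % (M : ℤ) = (M : ℤ) - 1 then (1 : ℝ) else 0) else 0)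
          * SrecAt d Lc (toSite r) cE cVH cΛ 0 κ u xz.1 xz.2 (Sum.inl α) (Sum.inl α) = 0 := by
  classical
  have hLc : 1 ≤ Lc := one_le_of_neZero Lc
  have hF : ∀ t : ℤ, (((((t + 1) / (M : ℤ) : ℤ)) : ℝ)) - (((t / (M : ℤ) : ℤ)) : ℝ) = if t % (M : ℤ) = (M : ℤ) - 1 then (1 : ℝ) else 0 :=
    staircase_forwardDiff hM
  rw [tsum_prod_exitWt_srecAt_zero hLc hr cE cVH cΛ (F₁ := fun t : ℤ => (((t / (M : ℤ) : ℤ)) : ℝ)) (F₂ := fun t : ℤ => (((t / (M : ℤ) : ℤ)) : ℝ))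
    hF hF (fun s => abs_exitInd_le_one _ s) (fun s => abs_exitInd_le_one _ s) κ u α α, curvAdj_curv_const_mul,
    curvAdj_curv_pairForm_coord_same (fun t => (((t / (Lc : ℤ) / (M : ℤ) : ℤ)) : ℝ)) (fun t => (((t / (Lc : ℤ) / (M : ℤ) : ℤ)) : ℝ)) α κ u, mul_zero]

/-! ## §3 The base of the parity tower: the level-0 charge function is odd under the slot inversion -/

/-- NOT IN PRINT; OUR BOOKKEEPING.  **THE BASE OF THE PARITY TOWER, FULL MEMBER, PULLED-BACK WEIGHTS** (in-block root, all `cE cVH cΛ`, ALL `α β`, every `M ≥ 1`, every integer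
vector `t`, centre `c := (Lc·M)•t + (Lc·M − 1)•𝟙`, every slot `(κ, u)`): the level-0 charge function against `𝟙^{exit,Lc}_α·𝟙^{exit,M}(blk_α) ⊗ 𝟙^{exit,Lc}_β·𝟙^{exit,M}(blk_β)`
satisfies `C_0(κ, c − e_κ − u) = −C_0(κ, u)` (§2's closed form ⨾ §1's parity; `α = β`: both sides vanish). -/
theorem exitCharge_srecAt_zero_pointInv (hr : r ∈ box (d + 1) Lc) (cE cVH cΛ : ℝ) (α β : Fin (d + 1)) {M : ℕ} (hM : 1 ≤ M) (t : Site (d + 1))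
    (κ : Fin (d + 1)) (u : Site (d + 1)) :
    ∑' xz : Site (d + 1) × Site (d + 1),
        (if xz.1 α % (Lc : ℤ) = (Lc : ℤ) - 1 then (if blk Lc xz.1 α % (M : ℤ) = (M : ℤ) - 1 then (1 : ℝ) else 0) else 0)
          * (if xz.2 β % (Lc : ℤ) = (Lc : ℤ) - 1 then (if blk Lc xz.2 β % (M : ℤ) = (M : ℤ) - 1 then (1 : ℝ) else 0) else 0)
          * SrecAt d Lc (toSite r) cE cVH cΛ 0 κ (((Lc * M : ℕ) : ℤ) • t + (fun _ : Fin (d + 1) => ((Lc * M : ℕ) : ℤ) - 1) - unitVec κ - u) xz.1 xz.2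
            (Sum.inl α) (Sum.inl β)
      = -∑' xz : Site (d + 1) × Site (d + 1),
        (if xz.1 α % (Lc : ℤ) = (Lc : ℤ) - 1 then (if blk Lc xz.1 α % (M : ℤ) = (M : ℤ) - 1 then (1 : ℝ) else 0) else 0)
          * (if xz.2 β % (Lc : ℤ) = (Lc : ℤ) - 1 then (if blk Lc xz.2 β % (M : ℤ) = (M : ℤ) - 1 then (1 : ℝ) else 0) else 0)
          * SrecAt d Lc (toSite r) cE cVH cΛ 0 κ u xz.1 xz.2 (Sum.inl α) (Sum.inl β) := by
  have hLc : 1 ≤ Lc := one_le_of_neZero Lc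
  have hL : 1 ≤ Lc * M := Nat.one_le_iff_ne_zero.2 (Nat.mul_ne_zero (by omega) (by omega))
  by_cases hαβ : α = β
  · subst hαβ
    rw [tsum_exitWt_srecAt_zero_same hr cE cVH cΛ α hM, tsum_exitWt_srecAt_zero_same hr cE cVH cΛ α hM, neg_zero]
  · rw [tsum_exitWt_srecAt_zero_eq_curvAdj_cornerForm hr cE cVH cΛ hαβ hM, tsum_exitWt_srecAt_zero_eq_curvAdj_cornerForm hr cE cVH cΛ hαβ hM,
      curvAdj_cornerForm_pointInv hL t α β κ u]
    ring

/-- NOT IN PRINT; OUR BOOKKEEPING.  **THE BASE OF THE PARITY TOWER, PURE MEMBER, PRODUCT-PERIOD WEIGHTS** (in-block root, all `cE cVH cΛ`, ALL `α β`, every `M ≥ 1`, every integer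
vector `t`, `c := (Lc·M)•t + (Lc·M − 1)•𝟙`, every slot): with `C_0(κ,u) := Σ'_{(x,z)} 𝟙^{exit,Lc·M}_α(x)·𝟙^{exit,Lc·M}_β(z)·SpureRecAt … 0 κ u x z (inl α)(inl β)`,
`C_0(κ, c − e_κ − u) = −C_0(κ, u)` ((W) `exitWt_blk_eq` ⨾ PART D `tsum_prod_exitWt_srecAt_eq_spureRecAt` at `j = 0` ⨾ the previous theorem). -/
theorem exitCharge_spureRecAt_zero_pointInv (hr : r ∈ box (d + 1) Lc) (cE cVH cΛ : ℝ) (α β : Fin (d + 1)) {M : ℕ} (hM : 1 ≤ M) (t : Site (d + 1))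
    (κ : Fin (d + 1)) (u : Site (d + 1)) :
    ∑' xz : Site (d + 1) × Site (d + 1),
        (if xz.1 α % ((Lc * M : ℕ) : ℤ) = ((Lc * M : ℕ) : ℤ) - 1 then (1 : ℝ) else 0) * (if xz.2 β % ((Lc * M : ℕ) : ℤ) = ((Lc * M : ℕ) : ℤ) - 1 then (1 : ℝ) else 0)
          * SpureRecAt d Lc (toSite r) cE cVH cΛ 0 κ (((Lc * M : ℕ) : ℤ) • t + (fun _ : Fin (d + 1) => ((Lc * M : ℕ) : ℤ) - 1) - unitVec κ - u) xz.1 xz.2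
            (Sum.inl α) (Sum.inl β)
      = -∑' xz : Site (d + 1) × Site (d + 1),
        (if xz.1 α % ((Lc * M : ℕ) : ℤ) = ((Lc * M : ℕ) : ℤ) - 1 then (1 : ℝ) else 0) * (if xz.2 β % ((Lc * M : ℕ) : ℤ) = ((Lc * M : ℕ) : ℤ) - 1 then (1 : ℝ) else 0)
          * SpureRecAt d Lc (toSite r) cE cVH cΛ 0 κ u xz.1 xz.2 (Sum.inl α) (Sum.inl β) := by
  have hLc : 1 ≤ Lc := one_le_of_neZero Lc
  -- pure member, product-period weights ↦ full member, pulled-back weights (PART D at `j = 0`, (W) backwards)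
  have conv : ∀ v : Site (d + 1), ∑' xz : Site (d + 1) × Site (d + 1),
      (if xz.1 α % ((Lc * M : ℕ) : ℤ) = ((Lc * M : ℕ) : ℤ) - 1 then (1 : ℝ) else 0) * (if xz.2 β % ((Lc * M : ℕ) : ℤ) = ((Lc * M : ℕ) : ℤ) - 1 then (1 : ℝ) else 0)
        * SpureRecAt d Lc (toSite r) cE cVH cΛ 0 κ v xz.1 xz.2 (Sum.inl α) (Sum.inl β)
      = ∑' xz : Site (d + 1) × Site (d + 1),
        (if xz.1 α % (Lc : ℤ) = (Lc : ℤ) - 1 then (if blk Lc xz.1 α % (M : ℤ) = (M : ℤ) - 1 then (1 : ℝ) else 0) else 0)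
          * (if xz.2 β % (Lc : ℤ) = (Lc : ℤ) - 1 then (if blk Lc xz.2 β % (M : ℤ) = (M : ℤ) - 1 then (1 : ℝ) else 0) else 0)
          * SrecAt d Lc (toSite r) cE cVH cΛ 0 κ v xz.1 xz.2 (Sum.inl α) (Sum.inl β) := by
    intro v
    rw [tsum_prod_exitWt_srecAt_eq_spureRecAt hLc hr cE cVH cΛ 0
      (f₁ := fun s : ℤ => if s % (M : ℤ) = (M : ℤ) - 1 then (1 : ℝ) else 0) (f₂ := fun s : ℤ => if s % (M : ℤ) = (M : ℤ) - 1 then (1 : ℝ) else 0)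
      (fun s => abs_exitInd_le_one _ s) (fun s => abs_exitInd_le_one _ s) κ v α β]
    refine tsum_congr fun xz => ?_
    rw [exitWt_blk_eq hLc hM xz.1 α, exitWt_blk_eq hLc hM xz.2 β]
  rw [conv, conv, exitCharge_srecAt_zero_pointInv hr cE cVH cΛ α β hM t κ u]

end Level0

end Summit.QuantumFields.BalabanUV.Beta.GAN24.ExitChargeParityBase

end
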